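import Summits.ABC.ABC.Theorems.SoloBlindPolyABC
import HarnessLib

/-!
# The abc exponent set: `{K | PolyABC K}` is an up-set inside `(1, ∞)`, and abc says it is `(1, ∞)`

Solo seat `solo-ABC-blind` (ideation tier, summit-directed), session 6.

Write `E := {K : ℝ | PolyABC K}` for the set of exponents `K` such that `c ≤ C_K · rad(abc)^K` holds
for all abc triples (`PolyABC`, `SoloBlindCycloRad`).  Unconditionally and in kernel form:

* `E` is an up-set (`polyABC_mono`, `SoloBlindPolyABC`);
* `1 ∉ E` (`not_polyABC_one`): the epsilon in abc cannot be removed — witnessed by the triples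
  `(1, 3^(2^(k+1)) − 1, 3^(2^(k+1)))`, where `3^(2^(k+1)) ≡ 1 (mod 2^(k+3))` (`three_pow_two_pow_succ`)
  forces `rad(abc) ≤ 6 · (3^(2^(k+1)) − 1) / 2^(k+3)`, so `c / rad(abc) ≥ 2^(k+3)/6 → ∞`
  (indeed `c/rad ≫ log c`); hence `E ⊆ (1, ∞)` (`one_lt_of_polyABC`);
* `ABC ↔ E = Set.Ioi 1` (`abc_iff_polyABC_setOf_eq_Ioi`), while "weak/polynomial abc" is `E ≠ ∅`.

No element of `E` is known (the best unconditional bound, Stewart–Yu 2001, is `log c ≪ rad^{1/3+ε}`,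
not polynomial); the much stronger unconditional lower bound `c > rad · exp((4−δ)√(log c)/log log c)`
infinitely often is Stewart–Tijdeman 1986 (Bombieri–Gubler, *Heights*, Thm 12.4.6, p. 413), not
formalised here.

References: Stewart–Tijdeman, Monatsh. Math. 102 (1986) 251–257 [StewartTijdeman1986];
Bombieri–Gubler, *Heights in Diophantine Geometry* (2006) Thm 12.4.6 [BombieriGubler2006];
Granville–Tucker, Notices AMS 49 (2002) 1224–1231 [GranvilleTucker2002].
-/

noncomputable section

open UniqueFactorizationMonoid

namespace Summit.ABC.ABC.Theorems

open Literature.NumberTheory.DiophantineGeometry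

/-- Lifting the exponent at `2` for `3^(2^(k+1))`: `3^(2^(k+1)) = 2^(k+3)·s + 1` for some `s`.
[folklore] -/
theorem three_pow_two_pow_succ (k : ℕ) : ∃ s : ℕ, 3 ^ (2 ^ (k + 1)) = 2 ^ (k + 3) * s + 1 := by
  induction k with
  | zero => exact ⟨1, by norm_num⟩
  | succ k ih =>
    obtain ⟨s, hs⟩ := ih
    refine ⟨2 ^ (k + 2) * s ^ 2 + s, ?_⟩
    have h : 3 ^ (2 ^ (k + 1 + 1)) = (3 ^ (2 ^ (k + 1))) ^ 2 := by
      rw [← pow_mul, ← pow_succ]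
    rw [h, hs]
    ring

/-- `rad(p^j · t) ∣ p · t`: a `j`-th power in `n` costs the radical a factor `p^(j-1)`. [folklore] -/
theorem radical_pow_mul_dvd (p j t : ℕ) : radical (p ^ j * t) ∣ p * t := by
  rcases eq_or_ne j 0 with rfl | hj
  · rw [pow_zero, one_mul]
    exact radical_dvd_self.trans (dvd_mul_left t p)
  calc radical (p ^ j * t) ∣ radical (p ^ j) * radical t := radical_mul_dvd
    _ = radical p * radical t := by rw [radical_pow p hj]
    _ ∣ p * t := mul_dvd_mul radical_dvd_self radical_dvd_self

/-- The radical of the witness triple `(1, 2^(k+3)·s, 3^(2^(k+1)))` divides `6 s`. [folklore] -/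
theorem rad_witness_dvd {k s : ℕ} (hs : 3 ^ (2 ^ (k + 1)) = 2 ^ (k + 3) * s + 1) :
    (rad 1 (2 ^ (k + 3) * s) (2 ^ (k + 3) * s + 1) : ℕ) ∣ 6 * s := by
  rw [rad_def, one_mul, ← hs]
  calc radical (2 ^ (k + 3) * s * 3 ^ (2 ^ (k + 1)))
        ∣ radical (2 ^ (k + 3) * s) * radical (3 ^ (2 ^ (k + 1))) := radical_mul_dvd
    _ = radical (2 ^ (k + 3) * s) * radical 3 := by
        rw [radical_pow 3 (by positivity : 2 ^ (k + 1) ≠ 0)]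
    _ ∣ (2 * s) * 3 := mul_dvd_mul (radical_pow_mul_dvd 2 (k + 3) s) radical_dvd_self
    _ = 6 * s := by ring

/-- **The epsilon in abc cannot be removed**: `¬ PolyABC 1`, i.e. for every `C` some abc triple
has `c > C · rad(abc)`.  Witnesses `(1, 3^(2^(k+1)) − 1, 3^(2^(k+1)))`. [folklore] -/
theorem not_polyABC_one : ¬ PolyABC 1 := by
  rintro ⟨C, hC, HC⟩
  obtain ⟨s, hs⟩ := three_pow_two_pow_succ ⌈C⌉₊
  have hs0 : 0 < s := by
    rcases Nat.eq_zero_or_pos s with h0 | h0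
    · exfalso
      rw [h0, mul_zero, zero_add] at hs
      have h9 : 3 ^ 2 ≤ 3 ^ (2 ^ (⌈C⌉₊ + 1)) :=
        Nat.pow_le_pow_right (by norm_num) (by
          calc 2 = 2 ^ 1 := by norm_num
            _ ≤ 2 ^ (⌈C⌉₊ + 1) := Nat.pow_le_pow_right (by norm_num) (by omega))
      omega
    · exact h0
  have hb0 : 0 < 2 ^ (⌈C⌉₊ + 3) * s := by positivity
  have habc := isABCTriple_one (2 ^ (⌈C⌉₊ + 3) * s) hb0
  have h1 := HC 1 (2 ^ (⌈C⌉₊ + 3) * s) (2 ^ (⌈C⌉₊ + 3) * s + 1) habc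
  rw [Real.rpow_one] at h1
  have hrad := rad_witness_dvd hs
  have hR : ((rad 1 (2 ^ (⌈C⌉₊ + 3) * s) (2 ^ (⌈C⌉₊ + 3) * s + 1) : ℕ) : ℝ) ≤ 6 * (s : ℝ) := by
    exact_mod_cast Nat.le_of_dvd (by omega) hrad
  have hCk : C ≤ (⌈C⌉₊ : ℝ) := Nat.le_ceil C
  have hk2 : (⌈C⌉₊ : ℝ) + 1 ≤ (2 : ℝ) ^ ⌈C⌉₊ := by
    have := (Nat.lt_pow_self (by norm_num : 1 < 2) : ⌈C⌉₊ < 2 ^ ⌈C⌉₊)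
    exact_mod_cast this
  have hsR : (1 : ℝ) ≤ s := by exact_mod_cast hs0
  have hc : (((2 ^ (⌈C⌉₊ + 3) * s + 1 : ℕ)) : ℝ) = 8 * (2 : ℝ) ^ ⌈C⌉₊ * s + 1 := by
    push_cast; ring
  rw [hc] at h1
  -- chain: 8·2^k·s + 1 ≤ C·rad ≤ 6 C s ≤ 6 k s ≤ 6 (2^k − 1) s < 8·2^k·s + 1
  have h2 : C * ((rad 1 (2 ^ (⌈C⌉₊ + 3) * s) (2 ^ (⌈C⌉₊ + 3) * s + 1) : ℕ) : ℝ) ≤ C * (6 * s) :=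
    mul_le_mul_of_nonneg_left hR hC.le
  have h3 : C * (6 * (s : ℝ)) ≤ (⌈C⌉₊ : ℝ) * (6 * s) :=
    mul_le_mul_of_nonneg_right hCk (by positivity)
  have h4 : (⌈C⌉₊ : ℝ) * (6 * s) ≤ ((2 : ℝ) ^ ⌈C⌉₊ - 1) * (6 * s) :=
    mul_le_mul_of_nonneg_right (by linarith) (by positivity)
  have h5 : (0 : ℝ) ≤ (2 : ℝ) ^ ⌈C⌉₊ * s := by positivity
  nlinarith

/-- Every polynomial abc exponent exceeds `1`: `PolyABC K → 1 < K`. [folklore] -/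
theorem one_lt_of_polyABC {K : ℝ} (h : PolyABC K) : 1 < K := by
  by_contra hK
  push Not at hK
  exact not_polyABC_one (polyABC_mono h hK)

/-- The exponent set is contained in `(1, ∞)`, unconditionally. [folklore] -/
theorem polyABC_setOf_subset_Ioi : {K : ℝ | PolyABC K} ⊆ Set.Ioi 1 :=
  fun _ hK => one_lt_of_polyABC hK

/-- **Coordinate**: `ABC` holds iff the abc exponent set `{K | PolyABC K}` is exactly `(1, ∞)`.
[folklore] -/
theorem abc_iff_polyABC_setOf_eq_Ioi : ABC ↔ {K : ℝ | PolyABC K} = Set.Ioi 1 := by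
  rw [abc_iff_polyABC]
  constructor
  · intro h
    ext K
    exact ⟨fun hK => one_lt_of_polyABC hK, fun hK => h K hK⟩
  · intro h K hK
    have hK' : K ∈ Set.Ioi (1 : ℝ) := hK
    rw [← h] at hK'
    exact hK'

end Summit.ABC.ABC.Theorems

end
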